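/-
Copyright (c) 2026 the pub-hodgecm-mathlib formalisation cell (harness21).  Prover seat hodgecm-mathlib-LH7-p09 (g3) (MIX-HI family, β₂ WORDs #34∕#36, lead LH4-p13 (g10) «LH7-p09: U-MIX worker»): the ONE upper-line LOW cell worker (RAY ∪ MIX, `b ≤ j`), cloned from LH4-p19 (g3)'s ★ W3 `…Beta2ConesOffRowUpperRayWorker`, 2026-09-05.
-/
import Summits.HodgeConjecture.HodgeConjecture.Theorems.F0P3cDyRamBeta2ConesOffRowUpperOfBands          -- ★ p863760 (LH7-p09 (g2)): the consumer `offRowU_of_bands`; brings the OFF vocabulary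
import Summits.HodgeConjecture.HodgeConjecture.Theorems.F0P3cDyRamUpperMixCellLiteralReads           -- (this seat, (B)): `reads_of_gen6_upperMix`; brings ★ p864672 ∕ ★ p864917 (LH4-p13), ★ R1b-A, ★ p864599, ★ `…ConeCellFaceTube`
import Summits.HodgeConjecture.HodgeConjecture.Theorems.F0P3cDyRamUpperRayCellReads                  -- ★ p864444 (LH4-p19 (g3), R1b-A): `exists_vertexFrame_of_gen`, `dep_iff_ball`, `weight_ne_zero_iff_cls_of_gen6`
import Summits.HodgeConjecture.HodgeConjecture.Theorems.F0P3cDyRamUpperRayDigitConstancy             -- ★ p864601 (LH4-p19 (g3), W1): digit constancy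
import Summits.HodgeConjecture.HodgeConjecture.Theorems.F0P3cDyRamUpperLowCellLetters                 -- (this seat, (A)): `exists_cellLetters_upperLow`; brings ★ p864626 W2 (parity), ★ F3
import Summits.HodgeConjecture.HodgeConjecture.Theorems.F0P3cDyRamRamKFrameClassLetters               -- ★ p864373 (LH4-p19 (g3), F4): class letters, flip witness, reference pair
import Summits.HodgeConjecture.HodgeConjecture.Theorems.F0P3cDyRamConeCellCountSocketDep              -- ★ p864098 (LH4-p19 (g3), R0): the count socket `cellDiff_eq_zero_of_fibration_reads₄`
import Summits.HodgeConjecture.HodgeConjecture.Theorems.F0P3cDyRamSphereLabelDigits                   -- ★ p864202 (LH4-p19 (g3), F1): `card_filter_sphere_plus_eq_card_filter_not`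
import Summits.HodgeConjecture.HodgeConjecture.Theorems.F0P3cDyRamRowCellSocketFibre                  -- ★ p864078 (LH7-p10 (g3)): `fibre_ncard_eq_of_lit_of_gen`
import Summits.HodgeConjecture.HodgeConjecture.Theorems.F0P3cDyRamRowCellSocketLit                    -- ★ p863983 (LH4-p16 (g3)): `lit_of_near_of_gen`
import Summits.HodgeConjecture.HodgeConjecture.Theorems.F0P3cDyRamShellOfExactLevel                   -- ★ p863487 (LH4-p12 (g9)) FILE 10: `levelSetDep_inter_shell_and_eq_exactLevel_of_prod`
import Summits.HodgeConjecture.HodgeConjecture.Theorems.F0P3cDyRamMixHiClassForm                      -- ★ p864323 (LH4-p13 (g10)) §5: `cutSet_not_plus_eq_minus` (the `−` literal in class form)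
import Summits.HodgeConjecture.HodgeConjecture.Theorems.F0P3cDyRamDiagonalFixedClassSystems           -- ★ (LH4-p06): `exists_repr_fixedBall_card` (class systems of fixed digits)
import Summits.HodgeConjecture.HodgeConjecture.Theorems.F0P3cDyRamToricLevelCensusRamKAtThirdField    -- ★ (LH4 lineage): `forall_fixed_fixed_exists_mul_theta_eq_of_frame` (the type-RamK token `hFN`)
import Summits.HodgeConjecture.HodgeConjecture.Theorems.F0P3cDyRamConeWeightHalfSplit                 -- ★ (LH4 lineage): `exists_flipUnit_of_forall_fixed_fixed_isNorm` (★ p864917's flip unit)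
import Summits.HodgeConjecture.HodgeConjecture.Theorems.F0P3cDyRamPieceRowsWildUnit0OfExports          -- ★ p857318: `v_two_lt_one_of_not_isUnit_two`
import Literature.NumberTheory.LocalFields.WildQuadraticDatumNonNormUnit                             -- ★ Lit: `exists_unit_nonnorm_dichotomy_of_isRamifiedQuadraticDatum` (the unit non-norm `c₀`)
import HarnessLib

/-!
# Crux `H413`, line LH4 «(D-RAM) FOUR-FRAME» — STAGE-1b, row (2), (β₂) road (R-36), (OFF) residue: «THE UPPER-LINE LOW CELL WORKER» — on a cell `(j, b)` of the upper line
# (`j + m = jl + b`, `m < 2b`, `b ≤ j`) in the LOW band `m_c + 2b ≤ 2m` (RAY ∪ MIX, no RAY premise) the (β₂) labelled difference of the (OFF) residue vanishes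
Cell `hodgecm-mathlib` (D-0151), FLOOR 0, crux H413 = `stmt-HodgeConjecture-24833`, route `HCCMUnconditional`; squad F0∕P3c∕LH4 ∕ LH7; lane `--supports stmt-HodgeConjecture-24833
--as helper` (count-neutral).  THEOREMS ONLY (no `def`∕instance∕notation∕`sorry`, default heartbeats); ★-only imports; states NO law; (β₂) stays a HYPOTHESIS.  Binders = ★ W3's
BYTE FOR BYTE (‹OFF.letter.v2› block, floor `max (m_c) (tE + 1) ≤ N`), cell tail with `b ≤ j` and WITHOUT the RAY premise (so ★ p863760's `hU_mix`∕`hU_ray` and ★ p863936's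
`hD_mix`∕`hD_ray` are all instances).  WHY (MIX-HI lead LH4-p13 (g10) «LH7-p09: U-MIX worker»; β₂ WORD #42): ★ W3's digit road is UNIFORM on the LOW band once (i) hI is the
SHARP generator independence ★ p864599 (`|jEϖ|^{b+d−1} ≤ r` ⟺ `s ≥ d + ℓ₀` ⟸ LOW, `d ≥ 2`), (ii) the radius is `r := |ϖ|^{n_r}`, `n_r = 2d − 1 + c′`, `c′ = 2b + ℓ₀ − m ≥ 1`
(`|γ₁|·r = |ϖ|^{2d−1}`: hNX∕hψ ★ W1, ★ F1 at mesh `n_r`, `ρ = 2d − 1`; (hLit)∕(hF) at `r·|ξ₀|·|ccA| = r·|ϖE|^b`, `hdeep` at `n_r`; `hC` ★ W1 §1 ⟸ `c′ ≥ 1`), (iii) the reads avoid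
ray domination: the `−` literal goes to CLASS FORM (★ p864323 §5, `cE` a fixed unit non-norm ★ Lit), both shells to the exact level (★ FILE 10, LOW), and (B)
`reads_of_gen6_upperMix` reads them through ★ p864672∕★ p864917.  The rest is ★ W3 token for token (PARITY ★ W2 §1, ★ F4, cell letters (A), `dep_iff_ball`, ★ R0, hV∕hP
★ R1b-A, hLit ★ p863983, hF ★ p864078, hbase ★ F1).  HEAD `cellDiff_upperLine_low_eq_zero (N) (hN)`; consumers: `offRowUmix_holds`, `offRowDmix_holds` (heads file).
HONEST LABEL.  Count-neutral; nothing printed is asserted; no census law; `hU_mix`, `hD_mix`, ‹PRODBAL-U∕D› remain binders∕letters of their consumers until the heads land;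
`HC_CM` is proved only modulo the 7 printed citations (2 remaining named inputs: hLiu418 = `stmt-HodgeConjecture-24832`, h413 = `stmt-HodgeConjecture-24833`) until rung 0 closes.
References: [Kottwitz1986BaseChangeUnits] §1 pp. 240–241, §3; [Jacobowitz1962] §4; [Rogawski1990] §4.9 Prop. 4.9.1 (b) p. 55, §12.2; [Serre1979] Ch. III §3 Prop. 7, §6
Prop. 12; Ch. V §3 Cor. 3; Ch. XV §2.
-/

set_option autoImplicit false

noncomputable section

namespace Summit.HodgeConjecture.HodgeConjecture.Cruxes.H413.F0P3cDyRamBeta2ConesOffRowUpperLowWorker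

open scoped Valued WithZero Matrix MatrixGroups Pointwise Classical
open WithZero Finset
open Literature.NumberTheory.Automorphic Literature.NumberTheory.Automorphic.HermitianLattice Literature.NumberTheory.Automorphic.UnitaryLatticeTree
open Literature.NumberTheory.Automorphic.UnitaryThreeFourFrame (IsRamifiedQuadraticDatum normSign)
open Literature.NumberTheory.Rogawski1990
open Summit.HodgeConjecture.HodgeConjecture.Cruxes.H413.F0P3cDyRamFourFramePieces
open Summit.HodgeConjecture.HodgeConjecture.Cruxes.H413.F0P3cDyRamFourFrameCensusDefs (LatticeInLevel LatticeNearTransvShell)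
open Summit.HodgeConjecture.HodgeConjecture.Cruxes.H413.F0P3cDyRamStageOneBDefs (mcOfRecord)
open Summit.HodgeConjecture.HodgeConjecture.Cruxes.H413.F0P3cDyRamToricCensusDefs
open Summit.HodgeConjecture.HodgeConjecture.Cruxes.H413.F0P3cDyRamRowCleanCellBit (line_entry_mul_map_eq_one)
open Summit.HodgeConjecture.HodgeConjecture.Cruxes.H413.F0P3cDyRamPieceRowsWildUnit0OfExports (v_two_lt_one_of_not_isUnit_two)
open Summit.HodgeConjecture.HodgeConjecture.Cruxes.H413.F0P3cDyRamLabelShellFlipCardTwo (v_refSkew_eq)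
open Summit.HodgeConjecture.HodgeConjecture.Cruxes.H413.F0P3cDyRamShellOfExactLevel (levelSetDep_inter_shell_and_eq_exactLevel_of_prod)
open Summit.HodgeConjecture.HodgeConjecture.Cruxes.H413.F0P3cDyRamMixHiClassForm (cutSet_not_plus_eq_minus)
open Summit.HodgeConjecture.HodgeConjecture.Cruxes.H413.F0P3cDyRamToricLevelCensusRamKAtThirdField (forall_fixed_fixed_exists_mul_theta_eq_of_frame)
open Summit.HodgeConjecture.HodgeConjecture.Cruxes.H413.F0P3cDyRamConeWeightHalfSplit (exists_flipUnit_of_forall_fixed_fixed_isNorm)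
open Literature.NumberTheory.LocalFields.WildQuadraticDatum (exists_unit_nonnorm_dichotomy_of_isRamifiedQuadraticDatum)
open Summit.HodgeConjecture.HodgeConjecture.Cruxes.H413.F0P3cDyRamDiagonalFixedClassSystems (exists_repr_fixedBall_card)
open Summit.HodgeConjecture.HodgeConjecture.Cruxes.H413.F0P3cDyRamRowCellSocketLit (lit_of_near_of_gen)
open Summit.HodgeConjecture.HodgeConjecture.Cruxes.H413.F0P3cDyRamRowCellSocketFibre (fibre_ncard_eq_of_lit_of_gen)
open Summit.HodgeConjecture.HodgeConjecture.Cruxes.H413.F0P3cDyRamSphereLabelDigits (card_filter_sphere_plus_eq_card_filter_not)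
open Summit.HodgeConjecture.HodgeConjecture.Cruxes.H413.F0P3cDyRamConeCellCountSocketDep (cellDiff_eq_zero_of_fibration_reads₄)
open Summit.HodgeConjecture.HodgeConjecture.Cruxes.H413.F0P3cDyRamRamKFrameClassLetters (fgap_of_datum deep_of_datum dich_of_datum exists_flipWitness_of_frame exists_refPair_of_frame)
open Summit.HodgeConjecture.HodgeConjecture.Cruxes.H413.F0P3cDyRamUpperRayCellLetters (exists_eq_add_two_mul_of_level)
open Summit.HodgeConjecture.HodgeConjecture.Cruxes.H413.F0P3cDyRamUpperLowCellLetters (exists_cellLetters_upperLow)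
open Summit.HodgeConjecture.HodgeConjecture.Cruxes.H413.F0P3cDyRamUpperRayDigitConstancy (litStar_iff_of_near sphere_iff_of_near ball_mul_iff_of_near psi_iff_of_near)
open Summit.HodgeConjecture.HodgeConjecture.Cruxes.H413.F0P3cDyRamRowCellGeneratorIndependenceSharp (cls_iff_cls_and_v_sub_le_sharp_of_gen)
open Summit.HodgeConjecture.HodgeConjecture.Cruxes.H413.F0P3cDyRamUpperRayCellReads (exists_vertexFrame_of_gen dep_iff_ball weight_ne_zero_iff_cls_of_gen6)
open Summit.HodgeConjecture.HodgeConjecture.Cruxes.H413.F0P3cDyRamUpperMixCellLiteralReads (reads_of_gen6_upperMix)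
open Summit.HodgeConjecture.HodgeConjecture.Cruxes.H413.F0P3cDyRamNormPairsIffFrames (normSign_eq_one_or)

/-- **HEAD — «THE UPPER-LINE LOW CELL WORKER» (RAY ∪ MIX).**  Binders: `N` with the assembler floor `max (m_c) (tE + 1) ≤ N`; then ‹OFF.letter.v2› BYTE FOR BYTE (as ★ W3);
then the cell `(j, b)` with `1 ≤ b`, `b ≤ j`, `m < 2b`, the upper line `j + m = jl + b`, LOW `m_c + 2b ≤ 2m`, `IsOrd(lam)` — NO band premise.  THEN the labelled (β₂)
difference of the (OFF) residue's two literals over `levelSetDep(j, b; μ)` vanishes.  See the module docstring for the assembly.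
[cite: Kottwitz1986BaseChangeUnits, §1 pp. 240–241; §3] [cite: Jacobowitz1962, §4] [cite: Rogawski1990, §4.9 Prop. 4.9.1 (b) p. 55] [cite: Serre1979, Ch. III §3 Prop. 7; Ch. V §3 Cor. 3; Ch. XV §2] -/
theorem cellDiff_upperLine_low_eq_zero (N : ℕ → ℕ → ℕ → ℕ) (hN : ∀ d tE q, max (mcOfRecord d) (tE + 1) ≤ N d tE q) :
    ∀ (E M : Type) [Field E] [Valued E ℤᵐ⁰] [CompleteSpace E] [IsDiscreteValuationRing 𝒪[E]] [Finite 𝓀[E]]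
        [Field M] [Valued M ℤᵐ⁰] [CompleteSpace M] [IsDiscreteValuationRing 𝒪[M]] [Finite 𝓀[M]]
        (σ : E →+* E) (ϖ : E) (d tE : ℕ) (_hD : IsRamifiedQuadraticDatum σ ϖ d tE) (_hσσ : ∀ a, σ (σ a) = a) (_h2 : ¬ IsUnit (2 : 𝒪[E]))
        (jE : E →+* M) (ρ Θ : M →+* M) (α lam : M)
        (_hρρ : ∀ z, ρ (ρ z) = z) (_hvρ : ∀ z, Valued.v (ρ z) = Valued.v z) (_hρj : ∀ a, ρ (jE a) = jE a)
        (_hjv : ∀ a, Valued.v (jE a) ≤ 1 ↔ Valued.v a ≤ 1) (_hjfix : ∀ z : M, ρ z = z ↔ ∃ a, jE a = z) (_hΘj : ∀ a, Θ (jE a) = jE (σ a))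
        (_hΘΘ : ∀ z, Θ (Θ z) = z) (_hΘρ : ∀ z, Θ (ρ z) = ρ (Θ z)) (_hvΘ : ∀ z, Valued.v (Θ z) = Valued.v z)
        (_hα : ρ α ≠ α) (_hα1 : Valued.v α ≤ 1) (_hint : ∀ z : M, Valued.v z ≤ 1 → Valued.v ((z - ρ z) / (α - ρ α)) ≤ 1)
        (_hΘlam : Θ lam * lam = 1) (_hvlam : Valued.v lam = 1) (_hbasis : ∀ z : M, ∃! pq : E × E, z = jE pq.1 + jE pq.2 * lam)
        (_hU : Valued.v (α - ρ α) = 1) (_hτ : Valued.v (α - Θ α) < 1)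
        (_hσres : ∀ z : M, ρ z = z → Valued.v z ≤ 1 → Valued.v (Θ z - z) < 1) (_hres : ∀ z : M, Valued.v z ≤ 1 → Valued.v (z - Θ z) < 1)
        (_hΘne : ∃ x : M, Θ x ≠ x) (_hDM : IsRamifiedQuadraticDatum Θ (jE ϖ) d tE) (_hjiso : ∀ a, Valued.v (jE a) = Valued.v a)
        (_hq : Nat.card 𝓀[M] = Nat.card 𝓀[E] ^ 2) (_hjpow : ∀ (t : E) (n : ℤ), Valued.v (jE t) = Valued.v (jE ϖ) ^ n ↔ Valued.v t = Valued.v ϖ ^ n)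
        (_hEval : ∀ c : M, ρ c = c → c ≠ 0 → Valued.v c ≤ 1 → ∃ n : ℕ, Valued.v c = Valued.v (jE ϖ) ^ n)
        (_hϖmax : ∀ t : M, ρ t = t → Valued.v t < 1 → Valued.v t ≤ Valued.v (jE ϖ))
        (γ₂ : GL (Fin 2) E) (u : GL (Fin 1) E)
        (_hdet : (γ₂ : Matrix (Fin 2) (Fin 2) E).det * σ (γ₂ : Matrix (Fin 2) (Fin 2) E).det = 1)
        (_htr : (γ₂ : Matrix (Fin 2) (Fin 2) E).trace = (γ₂ : Matrix (Fin 2) (Fin 2) E).det * σ (γ₂ : Matrix (Fin 2) (Fin 2) E).trace)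
        (_hirr : ∀ x : E, x * x - (γ₂ : Matrix (Fin 2) (Fin 2) E).trace * x + (γ₂ : Matrix (Fin 2) (Fin 2) E).det ≠ 0)
        (_hlam2 : lam * lam = jE (γ₂ : Matrix (Fin 2) (Fin 2) E).trace * lam - jE (γ₂ : Matrix (Fin 2) (Fin 2) E).det)
        (_hρlam : ρ lam = jE (γ₂ : Matrix (Fin 2) (Fin 2) E).trace - lam) (m jl : ℕ) (_hm : Valued.v (lam - jE ((u : Matrix (Fin 1) (Fin 1) E) 0 0)) = WithZero.exp (-(m : ℤ)))
        (_hjl : Valued.v ((lam - jE ((u : Matrix (Fin 1) (Fin 1) E) 0 0)) - ρ (lam - jE ((u : Matrix (Fin 1) (Fin 1) E) 0 0))) = WithZero.exp (-(jl : ℤ)))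
        (_hs : Valued.v ((γ₂ : Matrix (Fin 2) (Fin 2) E).trace - 2) * Valued.v (ϖ ^ (d % 2)) ≤ Valued.v (ϖ ^ mcOfRecord d))
        (_hp : Valued.v ((γ₂ : Matrix (Fin 2) (Fin 2) E).det - (γ₂ : Matrix (Fin 2) (Fin 2) E).trace + 1) ≤ Valued.v (ϖ ^ mcOfRecord d))
        (_hNm : N d tE (Nat.card 𝓀[E]) ≤ m) (_hu1N : Valued.v (((u : Matrix (Fin 1) (Fin 1) E) 0 0) - 1) ≤ Valued.v (ϖ ^ N d tE (Nat.card 𝓀[E]))) (_hlam1 : Valued.v (lam - 1) ≤ Valued.v (jE ϖ ^ N d tE (Nat.card 𝓀[E])))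
        (_hu : Valued.v ((u : Matrix (Fin 1) (Fin 1) E) 0 0) = 1) (_hum : Valued.v (((u : Matrix (Fin 1) (Fin 1) E) 0 0) - 1) ≤ Valued.v (ϖ ^ mstarOfRecord d))
        (H₂ : Matrix (Fin 2) (Fin 2) E) (hW : E) (_hH₂ : IsUnit H₂.det) (_hH₂σ : (H₂.map σ)ᵀ = H₂) (_hhW : Valued.v hW = 1) (_hhWσ : σ hW = hW)
        (P₁ : GL (Fin 3) E) (_hA : formCongr σ P₁ ((StdForm.antidiagonal 3).over E) = (!![H₂ 0 0, 0, H₂ 0 1; 0, hW, 0; H₂ 1 0, 0, H₂ 1 1] : Matrix (Fin 3) (Fin 3) E))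
        (_hΓ : P₁ * endoGL (γ₂, u) * P₁⁻¹ ∈ unitaryGroupOfForm σ ((StdForm.antidiagonal 3).over E))
        (φ : (Fin 2 → E) →+ M) (h : M) (_hφs : ∀ (c : E) (x : Fin 2 → E), φ (c • x) = jE c * φ x) (_hφi : Function.Injective φ) (_hφo : Function.Surjective φ)
        (_hφγ : ∀ x, φ ((γ₂ : Matrix (Fin 2) (Fin 2) E).mulVec x) = lam * φ x)
        (_hform : ∀ x y, jE (pairing σ H₂ x y) = h * Θ (φ x) * φ y + ρ (h * Θ (φ x) * φ y)) (_hΘh : Θ h = h) (_hh : h ≠ 0)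
        (J R : ℕ) (f : ℕ → ℕ → AddSubgroup M → ℕ)
        (_hfinF : {L₃ : Submodule 𝒪[E] (Fin 3 → E) | IsSelfDualLattice σ ϖ (!![H₂ 0 0, 0, H₂ 0 1; 0, hW, 0; H₂ 1 0, 0, H₂ 1 1] : Matrix (Fin 3) (Fin 3) E) L₃ ∧ mapGL (endoGL (γ₂, u)) L₃ = L₃}.Finite)
        (_hR : ∀ L₃ : Submodule 𝒪[E] (Fin 3 → E), IsSelfDualLattice σ ϖ (!![H₂ 0 0, 0, H₂ 0 1; 0, hW, 0; H₂ 1 0, 0, H₂ 1 1] : Matrix (Fin 3) (Fin 3) E) L₃ →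
          mapGL (endoGL (γ₂, u)) L₃ = L₃ → ∀ b : ℕ, (∀ c : E, (Pi.single 1 c : Fin 3 → E) ∈ L₃ ↔ Valued.v c ≤ Valued.v ϖ ^ b) → b ≤ R)
        (_hJ : ¬ IsOrd ρ α (jE ϖ ^ (J + 1)) lam) (_hfinLS : ∀ j a, (levelSet ρ Θ α (jE ϖ) h j a).Finite)
        (_hf : ∀ (b j : ℕ) (Λ : AddSubgroup M) (x₀ : M) (r : E), 1 ≤ b → x₀ ≠ 0 → (∀ x, x ∈ Λ ↔ ∃ z, IsOrd ρ α (jE ϖ ^ j) z ∧ x = x₀ * z) →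
          IsOrd ρ α (jE ϖ ^ j) (dualGen ρ Θ α (jE ϖ ^ j) h x₀) → ¬ IsOrd ρ α (jE ϖ ^ j) (dualGen ρ Θ α (jE ϖ ^ j) h x₀ / jE ϖ) → Valued.v (dualGen ρ Θ α (jE ϖ ^ j) h x₀) = Valued.v (jE ϖ) ^ b →
          (∀ b', (∀ x ∈ Λ, Valued.v (h * Θ x * b' + ρ (h * Θ x * b')) ≤ 1) → (lam - jE ((u : Matrix (Fin 1) (Fin 1) E) 0 0)) * b' ∈ Λ) → IsOrd ρ α (jE ϖ ^ j) lam →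
          jE r = glueUnit ρ Θ α (jE ϖ ^ j) h (jE ϖ) (jE hW) x₀ b →
          f b j Λ = Nat.card {x : 𝒪[E] ⧸ 𝓂[E] ^ (2 * b) // ∃ u' : 𝒪[E], Ideal.Quotient.mk (𝓂[E] ^ (2 * b)) u' = x ∧ Valued.v ((u' : E) * σ u' - r) ≤ Valued.v (ϖ ^ (2 * b))}),
        ∀ j b : ℕ, 1 ≤ b → b ≤ j → m < 2 * b → j + m = jl + b → mcOfRecord d + 2 * b ≤ 2 * m → IsOrd ρ α (jE ϖ ^ j) lam →
                ((∑ᶠ Λ ∈ levelSetDep ρ Θ α (jE ϖ) h j b (lam - jE ((u : Matrix (Fin 1) (Fin 1) E) 0 0)) ∩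
                      {Λ | ∃ B : Submodule 𝒪[E] (Fin 2 → E), B.toAddSubgroup.map φ = Λ ∧
                        ∃ L₃ : Submodule 𝒪[E] (Fin 3 → E), IsSelfDualLattice σ ϖ (!![H₂ 0 0, 0, H₂ 0 1; 0, hW, 0; H₂ 1 0, 0, H₂ 1 1] : Matrix (Fin 3) (Fin 3) E) L₃ ∧
                          L₃ ⊓ LinearMap.ker ((LinearMap.proj (1 : Fin 3) : (Fin 3 → E) →ₗ[E] E).restrictScalars 𝒪[E]) =
                            B.map ((Matrix.toLin' (!![1, 0; 0, 0; 0, 1] : Matrix (Fin 3) (Fin 2) E)).restrictScalars 𝒪[E]) ∧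
                          (∀ c : E, (Pi.single 1 c : Fin 3 → E) ∈ L₃ ↔ Valued.v c ≤ Valued.v ϖ ^ b) ∧
                          (LatticeNearTransvShell ϖ (d % 2) (mstarOfRecord d) ((((endoGL (γ₂, u) : GL (Fin 3) E) : Matrix (Fin 3) (Fin 3) E) - 1)) L₃ ∧
                            {z : E | ∃ y ∈ L₃, Valued.v ((ϖ ^ (mstarOfRecord d))⁻¹ * (z - pairing σ (!![H₂ 0 0, 0, H₂ 0 1; 0, hW, 0; H₂ 1 0, 0, H₂ 1 1] : Matrix (Fin 3) (Fin 3) E) y (((((endoGL (γ₂, u) : GL (Fin 3) E) : Matrix (Fin 3) (Fin 3) E) - 1)) *ᵥ y))) ≤ 1} =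
                              valueSetMod σ ϖ (mstarOfRecord d) (xPlus σ ϖ d))}, f b j Λ : ℕ) : ℤ) -
                  ((∑ᶠ Λ ∈ levelSetDep ρ Θ α (jE ϖ) h j b (lam - jE ((u : Matrix (Fin 1) (Fin 1) E) 0 0)) ∩
                      {Λ | ∃ B : Submodule 𝒪[E] (Fin 2 → E), B.toAddSubgroup.map φ = Λ ∧
                        ∃ L₃ : Submodule 𝒪[E] (Fin 3 → E), IsSelfDualLattice σ ϖ (!![H₂ 0 0, 0, H₂ 0 1; 0, hW, 0; H₂ 1 0, 0, H₂ 1 1] : Matrix (Fin 3) (Fin 3) E) L₃ ∧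
                          L₃ ⊓ LinearMap.ker ((LinearMap.proj (1 : Fin 3) : (Fin 3 → E) →ₗ[E] E).restrictScalars 𝒪[E]) =
                            B.map ((Matrix.toLin' (!![1, 0; 0, 0; 0, 1] : Matrix (Fin 3) (Fin 2) E)).restrictScalars 𝒪[E]) ∧
                          (∀ c : E, (Pi.single 1 c : Fin 3 → E) ∈ L₃ ↔ Valued.v c ≤ Valued.v ϖ ^ b) ∧
                          (LatticeNearTransvShell ϖ (d % 2) (mcOfRecord d) ((((endoGL (γ₂, u) : GL (Fin 3) E) : Matrix (Fin 3) (Fin 3) E) - 1)) L₃ ∧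
                            ¬ {z : E | ∃ y ∈ L₃, Valued.v ((ϖ ^ (mstarOfRecord d))⁻¹ * (z - pairing σ (!![H₂ 0 0, 0, H₂ 0 1; 0, hW, 0; H₂ 1 0, 0, H₂ 1 1] : Matrix (Fin 3) (Fin 3) E) y (((((endoGL (γ₂, u) : GL (Fin 3) E) : Matrix (Fin 3) (Fin 3) E) - 1)) *ᵥ y))) ≤ 1} =
                              valueSetMod σ ϖ (mstarOfRecord d) (xPlus σ ϖ d))}, f b j Λ : ℕ) : ℤ) = 0 := by
  intro E M _ _ _ _ _ _ _ _ _ _ σ ϖ d tE _hD _hσσ _h2 jE ρ Θ α lam _hρρ _hvρ _hρj _hjv _hjfix _hΘj _hΘΘ _hΘρ _hvΘ _hα _hα1 _hint _hΘlam _hvlam _hbasis _hU _hτ _hσres _hres _hΘne _hDM _hjiso _hq _hjpow _hEval _hϖmax γ₂ u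
    _hdet _htr _hirr _hlam2 _hρlam m jl _hm _hjl _hs _hp _hNm _hu1N _hlam1 _hu _hum H₂ hW _hH₂ _hH₂σ _hhW _hhWσ P₁ _hA _hΓ φ h _hφs _hφi _hφo _hφγ _hform _hΘh _hh J R f _hfinF _hR _hJ
    _hfinLS _hf j b hb1 hbj h2bm hline hlow hlamj
  obtain ⟨hσ, hvσ, hϖ, hfixE, hd, hd1, -⟩ := id _hD
  have hvϖ0 : Valued.v ϖ ≠ 0 := by rw [hϖ]; exact exp_ne_zero
  have hϖ0 : ϖ ≠ 0 := fun h0 => hvϖ0 (by rw [h0, map_zero])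
  have hϖlt : Valued.v ϖ < 1 := by rw [hϖ, ← exp_zero, exp_lt_exp]; norm_num
  have hϖle : Valued.v ϖ ≤ 1 := hϖlt.le
  have hjϖ : Valued.v (jE ϖ) = exp (-1 : ℤ) := by rw [_hjiso, hϖ]
  have hjϖ0 : jE ϖ ≠ 0 := (map_ne_zero jE).2 hϖ0
  have hjϖle : Valued.v (jE ϖ) ≤ 1 := by rw [_hjiso]; exact hϖle
  have hPn : ∀ n : ℕ, Valued.v (jE ϖ) ^ n = exp (-(n : ℤ)) := fun n => by rw [hjϖ, ← exp_nsmul]; congr 1; simp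
  have hPnE : ∀ n : ℕ, Valued.v ϖ ^ n = exp (-(n : ℤ)) := fun n => by rw [hϖ, ← exp_nsmul]; congr 1; simp
  have h2v : Valued.v (2 : E) < 1 := v_two_lt_one_of_not_isUnit_two _h2
  have hhW0 : hW ≠ 0 := fun h0 => by rw [h0, map_zero] at _hhW; exact zero_ne_one _hhW
  have huu := line_entry_mul_map_eq_one σ hhW0 _hA _hΓ
  have hhW1 : Valued.v (jE hW) = 1 := by rw [_hjiso, _hhW]
  have hms : mstarOfRecord d = d % 2 + 2 * d - 1 := rfl
  have hmc : mcOfRecord d = 2 * ((mstarOfRecord d + d) / 2) := rfl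
  have hmcN : mcOfRecord d ≤ N d tE (Nat.card 𝓀[E]) := le_of_max_le_left (hN d tE (Nat.card 𝓀[E]))
  have hn : 3 * d - 2 + d % 2 = mcOfRecord d := by rw [hmc, hms]; omega
  have hdb : d ≤ b := by omega
  have hd2 : 2 ≤ d := Literature.NumberTheory.LocalFields.WildQuadraticDatum.two_le_of_v_two_lt_one hσ hvσ hfixE hϖ hd _hD.2.2.2.2.2.2 h2v
  have h2d1 : Valued.v ϖ ^ (2 * d - 1) < 1 := pow_lt_one₀ zero_le hϖlt (by omega)
  have hccv : Valued.v (jE ϖ ^ j * (α - ρ α)) = exp (-(j : ℤ)) := by rw [Valuation.map_mul, _hU, mul_one, Valuation.map_pow, hPn]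
  have hcc : jE ϖ ^ j * (α - ρ α) ≠ 0 := fun h0 => by rw [h0, map_zero] at hccv; exact exp_ne_zero hccv.symm
  have hμρ : ρ (lam - jE ((u : Matrix (Fin 1) (Fin 1) E) 0 0)) ≠ lam - jE ((u : Matrix (Fin 1) (Fin 1) E) 0 0) := fun h0 => by
    have h1 := _hjl
    rw [h0, sub_self, map_zero] at h1; exact exp_ne_zero h1.symm
  have hskew : lam - ρ lam = (lam - jE ((u : Matrix (Fin 1) (Fin 1) E) 0 0)) - ρ (lam - jE ((u : Matrix (Fin 1) (Fin 1) E) 0 0)) := by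
    rw [map_sub, _hρj]; ring
  -- ★ FILE 10: both shells are the exact level `ℓ₀` (`M := m⋆` on the RAY band, `M := m_c` on the LOW band)
  have hμks : Valued.v (lam - jE ((u : Matrix (Fin 1) (Fin 1) E) 0 0)) ≤ Valued.v (jE ϖ) ^ (mstarOfRecord d - d % 2) := by
    rw [_hm, hPn, exp_le_exp]; omega
  have huks : Valued.v ((u : Matrix (Fin 1) (Fin 1) E) 0 0 - 1) ≤ Valued.v (ϖ ^ (mstarOfRecord d - d % 2)) :=
    _hum.trans (by rw [Valuation.map_pow, Valuation.map_pow]; exact pow_le_pow_right_of_le_one' hϖle (by omega))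
  have hprods : Valued.v (lam - jE ((u : Matrix (Fin 1) (Fin 1) E) 0 0)) *
        Valued.v ((lam - jE ((u : Matrix (Fin 1) (Fin 1) E) 0 0)) - ρ (lam - jE ((u : Matrix (Fin 1) (Fin 1) E) 0 0))) ≤
      Valued.v (jE ϖ ^ j * (α - ρ α)) * Valued.v (jE ϖ) ^ b * Valued.v (jE ϖ) ^ (mstarOfRecord d) := by
    rw [_hm, _hjl, hccv, hPn, hPn, ← exp_add, ← exp_add, ← exp_add, exp_le_exp]; omega
  have hμkc : Valued.v (lam - jE ((u : Matrix (Fin 1) (Fin 1) E) 0 0)) ≤ Valued.v (jE ϖ) ^ (mcOfRecord d - d % 2) := by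
    rw [_hm, hPn, exp_le_exp]; omega
  have hukc : Valued.v ((u : Matrix (Fin 1) (Fin 1) E) 0 0 - 1) ≤ Valued.v (ϖ ^ (mcOfRecord d - d % 2)) :=
    _hu1N.trans (by rw [Valuation.map_pow, Valuation.map_pow]; exact pow_le_pow_right_of_le_one' hϖle (by omega))
  have hprodc : Valued.v (lam - jE ((u : Matrix (Fin 1) (Fin 1) E) 0 0)) *
        Valued.v ((lam - jE ((u : Matrix (Fin 1) (Fin 1) E) 0 0)) - ρ (lam - jE ((u : Matrix (Fin 1) (Fin 1) E) 0 0))) ≤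
      Valued.v (jE ϖ ^ j * (α - ρ α)) * Valued.v (jE ϖ) ^ b * Valued.v (jE ϖ) ^ (mcOfRecord d) := by
    rw [_hm, _hjl, hccv, hPn, hPn, ← exp_add, ← exp_add, ← exp_add, exp_le_exp]; omega
  have eP := levelSetDep_inter_shell_and_eq_exactLevel_of_prod σ hσ hvσ hϖ _hH₂ _hH₂σ _hhW jE _hρρ _hvρ _hα _hα1 _hint _hΘΘ _hΘρ _hvΘ _hjv _hjfix _hjpow _hϖmax
    φ _hφs _hφi _hφo _hφγ _hvlam _hΘh _hh _hform u (d % 2) (mstarOfRecord d - d % 2) (mstarOfRecord d) (by omega) huks hb1 hlamj hμks hprods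
    (fun L₃ => {z : E | ∃ y ∈ L₃, Valued.v ((ϖ ^ (mstarOfRecord d))⁻¹ * (z - pairing σ (!![H₂ 0 0, 0, H₂ 0 1; 0, hW, 0; H₂ 1 0, 0, H₂ 1 1] : Matrix (Fin 3) (Fin 3) E) y
        (((((endoGL (γ₂, u) : GL (Fin 3) E) : Matrix (Fin 3) (Fin 3) E) - 1)) *ᵥ y))) ≤ 1} = valueSetMod σ ϖ (mstarOfRecord d) (xPlus σ ϖ d))
  -- the `−` literal in CLASS FORM (★ p864323 §5): `Shell_c ∧ ¬ VS = V(X₊)` ↦ `Shell_c ∧ VS = V(c₀ • X₊)`, `c₀` a fixed unit non-norm (★ Lit)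
  haveI : IsAdicComplete 𝓂[E] 𝒪[E] := Literature.NumberTheory.LocalFields.isAdicComplete_valuedInteger_of_completeSpace hϖ
  obtain ⟨cE, hσcE, hcE1, hcEN, -⟩ := exists_unit_nonnorm_dichotomy_of_isRamifiedQuadraticDatum σ ϖ d tE _hD
  rw [cutSet_not_plus_eq_minus σ ϖ d tE _hD _h2 jE ρ lam _hvρ _hjiso γ₂ u _hlam2 _hρlam hmcN _hu1N _hlam1 H₂ hW _hH₂σ _hhWσ P₁ _hA _hΓ φ b hσcE hcE1 hcEN]
  have eQ := levelSetDep_inter_shell_and_eq_exactLevel_of_prod σ hσ hvσ hϖ _hH₂ _hH₂σ _hhW jE _hρρ _hvρ _hα _hα1 _hint _hΘΘ _hΘρ _hvΘ _hjv _hjfix _hjpow _hϖmax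
    φ _hφs _hφi _hφo _hφγ _hvlam _hΘh _hh _hform u (d % 2) (mcOfRecord d - d % 2) (mcOfRecord d) (by omega) hukc hb1 hlamj hμkc hprodc
    (fun L₃ => {z : E | ∃ y ∈ L₃, Valued.v ((ϖ ^ (mstarOfRecord d))⁻¹ * (z - pairing σ (!![H₂ 0 0, 0, H₂ 0 1; 0, hW, 0; H₂ 1 0, 0, H₂ 1 1] : Matrix (Fin 3) (Fin 3) E) y
        (((((endoGL (γ₂, u) : GL (Fin 3) E) : Matrix (Fin 3) (Fin 3) E) - 1)) *ᵥ y))) ≤ 1} = valueSetMod σ ϖ (mstarOfRecord d) (cE • xPlus σ ϖ d))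
  beta_reduce at eP eQ
  rw [eP, eQ]
  -- the empty cell
  by_cases hempty : levelSet ρ Θ α (jE ϖ) h j b = ∅
  · have h0 : levelSetDep ρ Θ α (jE ϖ) h j b (lam - jE ((u : Matrix (Fin 1) (Fin 1) E) 0 0)) = ∅ :=
      Set.subset_eq_empty (levelSetDep_subset ρ Θ α (jE ϖ) h j b _) hempty
    rw [h0, Set.empty_inter, Set.empty_inter, finsum_mem_empty, Nat.cast_zero, sub_self]
  obtain ⟨Λ₀, hΛ₀⟩ := Set.nonempty_iff_ne_empty.2 hempty
  obtain ⟨x₀₀, -, -, -, -, hylev₀⟩ := hΛ₀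
  -- PARITY, the class letters, the reference pair, the cell letters
  obtain ⟨n, hjbn⟩ := exists_eq_add_two_mul_of_level (ρ := ρ) (α := α) _hDM _hΘΘ _hΘh _hU hbj hylev₀
  have hFgap := fgap_of_datum (ρ := ρ) _hDM
  have hdeep2 := deep_of_datum (ρ := ρ) _hD jE _hjv _hjfix _hΘj (n := 2 * d) (by omega)
  have hdeep1 := deep_of_datum (ρ := ρ) _hD jE _hjv _hjfix _hΘj (n := 2 * d - 1) le_rfl
  obtain ⟨c₀, -, hc₀1, -, hdich⟩ := dich_of_datum _hDM
  have hwit := exists_flipWitness_of_frame _hD jE _hjiso _hjfix _hΘj _hρρ _hvρ _hΘρ _hα1 _hU _hDM _hq _hσres _hτ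
  obtain ⟨κ₀, ξ₀, hκ₀, hΘκ₀, hξ, hΘξ, hξ0, hκ₀1, hξv⟩ := exists_refPair_of_frame _hD jE _hjiso _hjfix _hΘj _hρρ _hvρ _hΘρ _hα1 _hU _hDM _hq _hσres _hτ n
  have hlam3 : Valued.v (lam - 1) ≤ Valued.v (jE ϖ) ^ (3 * d - 2) :=
    _hlam1.trans (by rw [Valuation.map_pow]; exact pow_le_pow_right_of_le_one' hjϖle (by omega))
  obtain ⟨W, BE, γ₁, W₁, hWc, hBE, hσγ, hσW₁, hθ, hWW, hγn, hγ1, hγe, hW₁1⟩ :=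
    exists_cellLetters_upperLow (ρ := ρ) (Θ := Θ) _hD jE _hjiso _hjfix _hΘj _hρρ _hvρ _hΘρ _hΘlam _hvlam _hdet _hlam2 _hρlam hlam3 huu _hu _hm _hjl hjbn hline h2bm
      (by omega) hκ₀ hΘκ₀ hξ hΘξ hξ0 hκ₀1 hξv
  -- the socket radius `r = |ϖ|^{n_r}`, `n_r = 2d − 1 + c′`, `c′ = 2b + ℓ₀ − m ≥ 1`; `|γ₁| = e^{2b+ℓ₀−m}`
  set nr : ℕ := 2 * d - 1 + (2 * b + d % 2 - m) with hnrdef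
  have hγv : Valued.v γ₁ = exp ((b : ℤ) - ((m - b - d % 2 : ℕ) : ℤ)) := by
    rw [← mul_inv_cancel_right₀ (pow_ne_zero b hvϖ0) (Valued.v γ₁), hγn, hPnE, hPnE, ← exp_neg, ← exp_add]; congr 1; ring
  have hγrad : Valued.v γ₁ * Valued.v ϖ ^ nr = Valued.v ϖ ^ (2 * d - 1) := by
    rw [hγv, hPnE, hPnE, ← exp_add, exp_inj]; omega
  -- the type-RamK token, ★ p864917's flip unit
  have hFN := forall_fixed_fixed_exists_mul_theta_eq_of_frame (ρ := ρ) _hρρ _hvρ _hΘρ _hα1 _hU _hDM _hq _hσres _hτ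
  obtain ⟨zf, ξf, hzf1, hzξ, hσξf, hξN⟩ := exists_flipUnit_of_forall_fixed_fixed_isNorm σ _hD jE _hvΘ _hΘj _hjfix _hjpow hFN
  have hdeepr := deep_of_datum (ρ := ρ) _hD jE _hjv _hjfix _hΘj (n := nr) (by omega)
  have hRe : Valued.v ξ₀ * Valued.v (jE ϖ ^ j * (α - ρ α)) = Valued.v (jE ϖ) ^ b := by rw [hξv, hccv, hPn, ← exp_add]; congr 1; omega
  have hR : Valued.v (jE ϖ) ^ b ≤ Valued.v ξ₀ * Valued.v (jE ϖ ^ j * (α - ρ α)) := hRe.ge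
  have hκ₀v : Valued.v κ₀ ≤ Valued.v ξ₀ := hκ₀1.trans (by rw [hξv, ← exp_zero, exp_le_exp]; omega)
  have hlamρ : Valued.v (lam - ρ lam) ≤ Valued.v (jE ϖ ^ j * (α - ρ α)) * Valued.v (jE ϖ) ^ (d % 2 + 1) := by
    rw [hskew, _hjl, hccv, hPn, ← exp_add, exp_le_exp]; omega
  have hμY : Valued.v (lam - jE ((u : Matrix (Fin 1) (Fin 1) E) 0 0)) ≤ Valued.v (jE ϖ) ^ b := by rw [_hm, hPn, exp_le_exp]; omega
  have hμlb : Valued.v (lam - jE ((u : Matrix (Fin 1) (Fin 1) E) 0 0)) ≤ Valued.v (jE ϖ) ^ (d % 2 + 1 + b) := by rw [_hm, hPn, exp_le_exp]; omega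
  -- the SHARP transfer letter of (B): `|γ₁|·|ϖ|^{2b+d−1} ≤ |ϖ|^{2d−1}·|ϖE|^b` ⟸ `s ≥ d + ℓ₀`
  have hγrS : Valued.v γ₁ * Valued.v ϖ ^ (2 * b + d - 1) ≤ Valued.v ϖ ^ (2 * d - 1) * (Valued.v ξ₀ * Valued.v (jE ϖ ^ j * (α - ρ α))) := by
    rw [hγv, hRe, hPn, hPnE, hPnE, ← exp_add, ← exp_add, exp_le_exp]; omega
  -- `P = (ϖσϖ)^b`, `t₊`, the strict slope letter, the root ball
  have hP0 : (ϖ * σ ϖ) ^ b ≠ 0 := pow_ne_zero _ (mul_ne_zero hϖ0 ((map_ne_zero σ).2 hϖ0))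
  have hσP : σ ((ϖ * σ ϖ) ^ b) = (ϖ * σ ϖ) ^ b := by rw [map_pow, map_mul, hσ, mul_comm (σ ϖ) ϖ]
  have htpv := v_refSkew_eq hvσ hϖ hd
  have htp1 : Valued.v ((ϖ - σ ϖ) * ((ϖ * σ ϖ) ^ ((d - d % 2) / 2))⁻¹) ≤ 1 := by rw [htpv]; exact pow_le_one₀ zero_le hϖle
  have hWWt : Valued.v (γ₁ * (W - W₁)) * Valued.v ((ϖ - σ ϖ) * ((ϖ * σ ϖ) ^ ((d - d % 2) / 2))⁻¹) ≤ 1 := mul_le_one' (hWW.trans h2d1.le) htp1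
  have hγpos : (0 : ℤᵐ⁰) < Valued.v γ₁ := lt_of_lt_of_le zero_lt_one hγ1
  have hθlt : Valued.v (BE / ((ϖ * σ ϖ) ^ b * ((ϖ - σ ϖ) * ((ϖ * σ ϖ) ^ ((d - d % 2) / 2))⁻¹)) - γ₁) < Valued.v γ₁ :=
    hθ.trans_lt (by
      calc Valued.v γ₁ * Valued.v ϖ ^ (2 * d - 1) < Valued.v γ₁ * 1 := mul_lt_mul_of_pos_left h2d1 hγpos
        _ = Valued.v γ₁ := mul_one _)
  -- digit perturbations on `r`-balls, `r = |ϖ|^{n_r}`, `|γ₁|·r = |ϖ|^{2d−1}`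
  have hball : ∀ Ve V₀ : E, Valued.v (Ve - V₀) ≤ Valued.v ϖ ^ nr →
      Valued.v (V₀ - Ve) ≤ Valued.v ϖ ^ (2 * d - 1) ∧ Valued.v (γ₁ * (V₀ - Ve)) ≤ Valued.v ϖ ^ (2 * d - 1) ∧ Valued.v (γ₁ * (V₀ - Ve)) < 1 ∧
        Valued.v (γ₁ * (V₀ - Ve)) * Valued.v ((ϖ - σ ϖ) * ((ϖ * σ ϖ) ^ ((d - d % 2) / 2))⁻¹) ≤ 1 := by
    intro Ve V₀ hle
    have h1 : Valued.v (V₀ - Ve) ≤ Valued.v ϖ ^ nr := by rw [Valuation.map_sub_swap]; exact hle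
    have h2 : Valued.v (γ₁ * (V₀ - Ve)) ≤ Valued.v ϖ ^ (2 * d - 1) := by
      rw [Valuation.map_mul, ← hγrad]; exact mul_le_mul' le_rfl h1
    exact ⟨h1.trans (pow_le_pow_right_of_le_one' hϖle (by omega)), h2, h2.trans_lt h2d1, mul_le_one' (h2.trans h2d1.le) htp1⟩
  obtain ⟨Rd, hRd1, hRd2, hRd3, -⟩ := exists_repr_fixedBall_card hσ hvσ hfixE hϖ hd nr 0
  simp only [Nat.mul_zero, pow_zero, Nat.add_zero] at hRd1 hRd2 hRd3
  -- ★ p864078's radii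
  have hrR : Valued.v ϖ ^ nr * Valued.v ξ₀ * Valued.v (jE ϖ ^ j * (α - ρ α)) < Valued.v (jE ϖ) ^ b := by
    rw [mul_assoc, hRe, hPn, hPnE, ← exp_add, exp_lt_exp]; omega
  have hr₀ : Valued.v ϖ ^ nr * Valued.v ξ₀ * Valued.v (jE ϖ ^ j * (α - ρ α)) ≤ Valued.v (jE ϖ) ^ nr * Valued.v (jE ϖ) ^ b := by
    rw [mul_assoc, hRe, hPn, hPn, hPnE]
  -- «GEN6-fibre = GEN5-fibre over a digit satisfying the depth digit»
  have hfib : ∀ y : E, Valued.v (γ₁ * (y - W₁)) * Valued.v ((ϖ - σ ϖ) * ((ϖ * σ ϖ) ^ ((d - d % 2) / 2))⁻¹) ≤ 1 →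
      {Λ : AddSubgroup M | ∃ x₀ : M, (x₀ ≠ 0 ∧ (∀ x, x ∈ Λ ↔ ∃ ζ, IsOrd ρ α (jE ϖ ^ j) ζ ∧ x = x₀ * ζ) ∧
          IsOrd ρ α (jE ϖ ^ j) (dualGen ρ Θ α (jE ϖ ^ j) h x₀) ∧ ¬ IsOrd ρ α (jE ϖ ^ j) (dualGen ρ Θ α (jE ϖ ^ j) h x₀ / jE ϖ) ∧
          Valued.v (dualGen ρ Θ α (jE ϖ ^ j) h x₀) = Valued.v (jE ϖ) ^ b ∧
          (∀ b', (∀ x ∈ Λ, Valued.v (h * Θ x * b' + ρ (h * Θ x * b')) ≤ 1) → (lam - jE ((u : Matrix (Fin 1) (Fin 1) E) 0 0)) * b' ∈ Λ)) ∧ ((∃ e : M, ρ e = e ∧ e * Θ e = h * (x₀ * Θ x₀) + ρ (h * (x₀ * Θ x₀))) ↔ (∃ e : M, ρ e = e ∧ e * Θ e = -(h * ρ h * ((α - ρ α) * Θ (α - ρ α)) * jE hW))) ∧ Valued.v (((ρ (h * (x₀ * Θ x₀)) / (h * (x₀ * Θ x₀) + ρ (h * (x₀ * Θ x₀))) - κ₀)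 / ξ₀) - jE y) ≤ Valued.v ϖ ^ nr} =
      {Λ : AddSubgroup M | ∃ x₀ : M, (x₀ ≠ 0 ∧ (∀ x, x ∈ Λ ↔ ∃ ζ, IsOrd ρ α (jE ϖ ^ j) ζ ∧ x = x₀ * ζ) ∧
          IsOrd ρ α (jE ϖ ^ j) (dualGen ρ Θ α (jE ϖ ^ j) h x₀) ∧ ¬ IsOrd ρ α (jE ϖ ^ j) (dualGen ρ Θ α (jE ϖ ^ j) h x₀ / jE ϖ) ∧
          Valued.v (dualGen ρ Θ α (jE ϖ ^ j) h x₀) = Valued.v (jE ϖ) ^ b) ∧ ((∃ e : M, ρ e = e ∧ e * Θ e = h * (x₀ * Θ x₀) + ρ (h * (x₀ * Θ x₀))) ↔ (∃ e : M, ρ e = e ∧ e * Θ e = -(h * ρ h * ((α - ρ α) * Θ (α - ρ α)) * jE hW))) ∧ Valued.v (((ρ (h * (x₀ * Θ x₀)) / (h * (x₀ * Θ x₀) + ρ (h * (x₀ * Θ x₀))) - κ₀) / ξ₀) - jE y) ≤ Valued.v ϖ ^ nr} := by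
    intro y hy
    ext Λ
    constructor
    · rintro ⟨x₀, ⟨hx₀, hΛx, hyO, hyp, hylev, -⟩, hC, hnear⟩
      exact ⟨x₀, ⟨hx₀, hΛx, hyO, hyp, hylev⟩, hC, hnear⟩
    · rintro ⟨x₀, hG5, hC, hnear⟩
      obtain ⟨w₀, V, hw₀Y, -, -, hjV, hκ, -, hpwP⟩ := exists_vertexFrame_of_gen (α := α) _hD jE _hjiso _hjfix _hΘj _hρρ _hvρ _hΘΘ _hΘρ _hvΘ _hΘh _hh _hH₂σ
        φ _hφo _hform hb1 hcc hFgap hκ₀ hΘκ₀ hξ hΘξ hξ0 hκ₀v hR Λ x₀ hG5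
      have hVy : Valued.v (V - y) ≤ Valued.v ϖ ^ nr := by rw [← _hjiso, map_sub, hjV]; exact hnear
      have hdepV : Valued.v (γ₁ * (V - W₁)) * Valued.v ((ϖ - σ ϖ) * ((ϖ * σ ϖ) ^ ((d - d % 2) / 2))⁻¹) ≤ 1 := (ball_mul_iff_of_near (hball V y hVy).2.2.2).2 hy
      exact ⟨x₀, ⟨hG5.1, hG5.2.1, hG5.2.2.1, hG5.2.2.2.1, hG5.2.2.2.2,
        (dep_iff_ball _hD jE _hjv _hjfix _hρρ _hvρ _hα _hα1 _hint _hΘΘ _hΘρ _hvΘ _hΘh _hh H₂ φ _hform hcc hμρ hμY Λ x₀ hG5 hw₀Y hκ hWc hBE hP0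
          hpwP hθlt hWWt).2 hdepV⟩, hC, hnear⟩
  -- (B): the two literal reads of every populated member, read through ★ p864672 ∕ ★ p864917
  have hreads := fun (Λ : AddSubgroup M) (x₀ : M) hG hfne =>
    reads_of_gen6_upperMix _hD _h2 jE _hjiso _hjfix _hΘj _hjpow _hϖmax _hρρ _hvρ _hα _hα1 _hint _hΘΘ _hΘρ _hvΘ _hDM _hΘh _hh _hH₂ _hH₂σ _hhW _hhWσ
      φ _hφs _hφi _hφo _hφγ _hvlam _hform _hlam2 _hρlam u P₁ _hA _hΓ hmcN _hu1N _hlam1 hb1 hdb hbj hcc hlamj hμlb hlamρ hμkc hprodc f _hf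
      (fun Λ => ∃ (x₀ : M) (e₀ : E), x₀ ≠ 0 ∧ (∀ x, x ∈ Λ ↔ ∃ ζ, IsOrd ρ α (jE ϖ ^ j) ζ ∧ x = x₀ * ζ) ∧
      IsOrd ρ α (jE ϖ ^ j) (dualGen ρ Θ α (jE ϖ ^ j) h x₀) ∧ ¬ IsOrd ρ α (jE ϖ ^ j) (dualGen ρ Θ α (jE ϖ ^ j) h x₀ / jE ϖ) ∧
      Valued.v (dualGen ρ Θ α (jE ϖ ^ j) h x₀) = Valued.v (jE ϖ) ^ b ∧
      jE e₀ = (lam - jE ((u : Matrix (Fin 1) (Fin 1) E) 0 0)) / (jE ϖ ^ j * (α - ρ α) * Θ (dualGen ρ Θ α (jE ϖ ^ j) h x₀)) +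
        ρ ((lam - jE ((u : Matrix (Fin 1) (Fin 1) E) 0 0)) / (jE ϖ ^ j * (α - ρ α) * Θ (dualGen ρ Θ α (jE ϖ ^ j) h x₀))) ∧
      Valued.v e₀ = Valued.v ϖ ^ (d % 2))
      (fun _ => Iff.rfl)
      (fun Λ => ∃ (x₀ : M) (r e₀ e' : E), x₀ ≠ 0 ∧ (∀ x, x ∈ Λ ↔ ∃ ζ, IsOrd ρ α (jE ϖ ^ j) ζ ∧ x = x₀ * ζ) ∧
      IsOrd ρ α (jE ϖ ^ j) (dualGen ρ Θ α (jE ϖ ^ j) h x₀) ∧ ¬ IsOrd ρ α (jE ϖ ^ j) (dualGen ρ Θ α (jE ϖ ^ j) h x₀ / jE ϖ) ∧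
      Valued.v (dualGen ρ Θ α (jE ϖ ^ j) h x₀) = Valued.v (jE ϖ) ^ b ∧
      σ r = r ∧ Valued.v r = 1 ∧ jE r = glueUnit ρ Θ α (jE ϖ ^ j) h (jE ϖ) (jE hW) x₀ b ∧
      jE e₀ = (lam - jE ((u : Matrix (Fin 1) (Fin 1) E) 0 0)) / (jE ϖ ^ j * (α - ρ α) * Θ (dualGen ρ Θ α (jE ϖ ^ j) h x₀)) +
        ρ ((lam - jE ((u : Matrix (Fin 1) (Fin 1) E) 0 0)) / (jE ϖ ^ j * (α - ρ α) * Θ (dualGen ρ Θ α (jE ϖ ^ j) h x₀))) ∧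
      σ e' = e' ∧ Valued.v e' = 1 ∧ Valued.v (e₀ - e' * ((ϖ - σ ϖ) * ((ϖ * σ ϖ) ^ ((d - d % 2) / 2))⁻¹)) ≤ Valued.v ϖ ^ mstarOfRecord d ∧
      ∃ c : E, c * σ c = r * e')
      (fun _ => Iff.rfl)
      zf hzf1 ξf hzξ hσξf hξN hσcE hcE1 hcEN hFgap hκ₀ hΘκ₀ hξ hΘξ hξ0 hκ₀v hR hWc hBE hP0 hσP rfl hσγ hσW₁ hθ hWW hγrS hμρ Λ x₀ hG hfne
  -- ★ p864098, the count socket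
  refine cellDiff_eq_zero_of_fibration_reads₄ σ hσ hvσ hϖ _hD h2v _hH₂σ _hhW _hhWσ jE _hρρ _hvρ _hα _hα1 _hint _hΘΘ _hΘρ _hvΘ _hΘj _hjv _hjfix _hjpow
    _hϖmax φ _hφs _hφi _hφo _hφγ _hvlam _hΘh _hh _hform ((u : Matrix (Fin 1) (Fin 1) E) 0 0) hb1 hdb hlamj f _hf _hjiso (_hfinLS j b)
    (fun x₀ => (∃ e : M, ρ e = e ∧ e * Θ e = h * (x₀ * Θ x₀) + ρ (h * (x₀ * Θ x₀)))) (fun x₀ => ((ρ (h * (x₀ * Θ x₀)) / (h * (x₀ * Θ x₀) + ρ (h * (x₀ * Θ x₀))) - κ₀) / ξ₀)) (∃ e : M, ρ e = e ∧ e * Θ e = -(h * ρ h * ((α - ρ α) * Θ (α - ρ α)) * jE hW)) (Valued.v ϖ ^ nr) Rd hRd2 hRd3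
    (fun V => ((Valued.v (κ₀ + jE V * ξ₀) * Valued.v (jE ϖ ^ j * (α - ρ α)) = Valued.v (jE ϖ) ^ b ∧ ∃ e : M, ρ e = e ∧ e * Θ e = (κ₀ + jE V * ξ₀) * ρ (κ₀ + jE V * ξ₀) / (h * ρ h)) ∧ Valued.v (γ₁ * (V - W₁)) * Valued.v ((ϖ - σ ϖ) * ((ϖ * σ ϖ) ^ ((d - d % 2) / 2))⁻¹) ≤ 1)) (fun V => (Valued.v (γ₁ * (V - W₁)) = 1)) (fun V => (Valued.v (γ₁ * (V - W₁)) = 1 → normSign σ (γ₁ * (V - W₁)) = normSign σ (-hW))) ?_ ?_ ?_ ?_ ?_ ?_ ?_ _ _ ?_ ?_ ?_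
  · -- hI: ★ p864599 SHARP generator independence (`|jEϖ|^{b+d−1} ≤ |ϖ|^{n_r}` ⟸ `s ≥ d + ℓ₀`)
    intro Λ x₀ x₀' hG hG'
    exact cls_iff_cls_and_v_sub_le_sharp_of_gen _hD jE _hjv _hjfix _hΘj _hρρ _hvρ _hΘΘ _hΘρ _hvΘ _hDM _hα _hα1 _hint _hΘh hb1 hdb hbj hcc hFgap hdeep2 κ₀ hξ0 hR
      (Valued.v ϖ ^ nr) (by rw [hPn, hPnE, exp_le_exp]; omega) Λ x₀ x₀' ⟨hG.1, hG.2.1, hG.2.2.1, hG.2.2.2.1, hG.2.2.2.2.1⟩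
      ⟨hG'.1, hG'.2.1, hG'.2.2.1, hG'.2.2.2.1, hG'.2.2.2.2.1⟩
  · -- hV: the digit of a member (★ R1b-A §1)
    intro Λ x₀ hG
    obtain ⟨w₀, V, -, hσV, hV1, hjV, -⟩ := exists_vertexFrame_of_gen (α := α) _hD jE _hjiso _hjfix _hΘj _hρρ _hvρ _hΘΘ _hΘρ _hvΘ _hΘh _hh _hH₂σ φ _hφo _hform
      hb1 hcc hFgap hκ₀ hΘκ₀ hξ hΘξ hξ0 hκ₀v hR Λ x₀ ⟨hG.1, hG.2.1, hG.2.2.1, hG.2.2.2.1, hG.2.2.2.2.1⟩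
    exact ⟨V, hjV, hσV, hV1⟩
  · -- hLit: a digit near a member is a literal digit (★ p863983) and satisfies the depth digit (★ R1b-A §2 + W1)
    intro Λ x₀ V₀ hG hV₀R hnear
    obtain ⟨hx₀, hΛx, hyO, hyp, hylev, hdep⟩ := hG
    refine ⟨lit_of_near_of_gen _hD jE _hjv _hjfix _hΘj _hρρ _hvρ _hΘΘ _hΘρ _hΘh _hh hb1 hcc hFgap hκ₀ hΘκ₀ hξ hΘξ hξ0 hrR hr₀ hdeepr Λ x₀
      ⟨hx₀, hΛx, hyO, hyp, hylev⟩ V₀ (hRd1 V₀ hV₀R).1 hnear, ?_⟩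
    obtain ⟨w₀, V, hw₀Y, -, -, hjV, hκ, -, hpwP⟩ := exists_vertexFrame_of_gen (α := α) _hD jE _hjiso _hjfix _hΘj _hρρ _hvρ _hΘΘ _hΘρ _hvΘ _hΘh _hh _hH₂σ
      φ _hφo _hform hb1 hcc hFgap hκ₀ hΘκ₀ hξ hΘξ hξ0 hκ₀v hR Λ x₀ ⟨hx₀, hΛx, hyO, hyp, hylev⟩
    have hdepV : Valued.v (γ₁ * (V - W₁)) * Valued.v ((ϖ - σ ϖ) * ((ϖ * σ ϖ) ^ ((d - d % 2) / 2))⁻¹) ≤ 1 :=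
      (dep_iff_ball _hD jE _hjv _hjfix _hρρ _hvρ _hα _hα1 _hint _hΘΘ _hΘρ _hvΘ _hΘh _hh H₂ φ _hform hcc hμρ hμY Λ x₀ ⟨hx₀, hΛx, hyO, hyp, hylev⟩ hw₀Y hκ
        hWc hBE hP0 hpwP hθlt hWWt).1 hdep
    have hVy : Valued.v (V - V₀) ≤ Valued.v ϖ ^ nr := by rw [← _hjiso, map_sub, hjV]; exact hnear
    exact (ball_mul_iff_of_near (hball V V₀ hVy).2.2.2).1 hdepV
  · -- hNX: the sphere is constant on `r`-balls (W1)
    intro Ve V₀ _ _ _ hnear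
    exact sphere_iff_of_near (hball Ve V₀ hnear).2.2.1
  · -- hψ: the sign implication is constant on `r`-balls (W1)
    intro Ve V₀ hσVe _ hV₀R hnear
    exact psi_iff_of_near _hD hσγ hσW₁ hσVe (hRd1 V₀ hV₀R).1 (hball Ve V₀ hnear).2.1 _
  · -- hF: ★ p864078 fibre count over literal digits, after GEN6-fibre = GEN5-fibre
    intro y hy y' hy'
    have hyL := (Finset.mem_filter.1 hy).2
    have hy'L := (Finset.mem_filter.1 hy').2
    rw [hfib y hyL.2, hfib y' hy'L.2]
    exact fibre_ncard_eq_of_lit_of_gen _hD jE _hjiso _hjfix _hΘj _hρρ _hvρ _hΘΘ _hΘρ _hΘh _hh hb1 hcc hFgap (_hfinLS j b) hc₀1 hdich hwit hκ₀ hΘκ₀ hξ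
      hΘξ hξ0 hrR hr₀ hdeepr (∃ e : M, ρ e = e ∧ e * Θ e = -(h * ρ h * ((α - ρ α) * Θ (α - ρ α)) * jE hW)) Rd (fun V hV => (hRd1 V hV).1) _ (fun V _ hV => hV.1) y hy y' hy'
  · -- hbase: ★ F1 digit balance on the sphere, with `C = LIT` (constant under the sphere's twists by W1 §1)
    have hC : ∀ V V' : E, σ V = V → Valued.v V ≤ 1 → σ V' = V' → Valued.v V' ≤ 1 → Valued.v (γ₁ * (V - W₁)) = 1 →
        Valued.v (γ₁ * (V' - V)) ≤ exp (-(2 * ((d - 1 : ℕ) : ℤ))) → (((Valued.v (κ₀ + jE V * ξ₀) * Valued.v (jE ϖ ^ j * (α - ρ α)) = Valued.v (jE ϖ) ^ b ∧ ∃ e : M, ρ e = e ∧ e * Θ e = (κ₀ + jE V * ξ₀) * ρ (κ₀ + jE V * ξ₀) / (h * ρ h)) ∧ Valued.v (γ₁ * (V - W₁)) * Valued.v ((ϖ - σ ϖ) * ((ϖ * σ ϖ) ^ ((d - d % 2) / 2))⁻¹) ≤ 1) ↔ ((Valued.v (κ₀ + jE V' * ξ₀) * Valued.v (jE ϖ ^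 j * (α - ρ α)) = Valued.v (jE ϖ) ^ b ∧ ∃ e : M, ρ e = e ∧ e * Θ e = (κ₀ + jE V' * ξ₀) * ρ (κ₀ + jE V' * ξ₀) / (h * ρ h)) ∧ Valued.v (γ₁ * (V' - W₁)) * Valued.v ((ϖ - σ ϖ) * ((ϖ * σ ϖ) ^ ((d - d % 2) / 2))⁻¹) ≤ 1)) := by
      intro V V' hσV _ hσV' _ _ hpert
      have h22 : exp (-(2 * ((d - 1 : ℕ) : ℤ))) = Valued.v ϖ ^ (2 * d - 2) := by rw [hPnE]; congr 1; omega
      rw [h22] at hpert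
      have hVV : Valued.v (V' - V) ≤ Valued.v ϖ ^ (2 * d - 1) := by
        have h1 : Valued.v γ₁ * Valued.v (V' - V) ≤ Valued.v γ₁ * Valued.v ϖ ^ (2 * d - 1) := by
          rw [← Valuation.map_mul]; exact hpert.trans hγe
        rcases le_or_gt (Valued.v (V' - V)) (Valued.v ϖ ^ (2 * d - 1)) with h | h
        · exact h
        · exact absurd h1 (not_le.2 (mul_lt_mul_of_pos_left h hγpos))
      refine and_congr (litStar_iff_of_near jE _hjiso _hjfix _hΘj _hρρ _hvρ _hΘρ hκ₀ hΘκ₀ hξ hΘξ hξ0 hRe hjϖ0 hdeep1 hσV hσV' hVV h2d1) ?_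
      exact ball_mul_iff_of_near (mul_le_one' (hpert.trans (pow_le_one₀ zero_le hϖle)) htp1)
    have hF1 := card_filter_sphere_plus_eq_card_filter_not _hD h2v hσγ hγ1 hσW₁ hW₁1 (n := nr) (ρ := 2 * d - 1) hγrad le_rfl Rd hRd1 hRd2 hRd3
      (fun V => ((Valued.v (κ₀ + jE V * ξ₀) * Valued.v (jE ϖ ^ j * (α - ρ α)) = Valued.v (jE ϖ) ^ b ∧ ∃ e : M, ρ e = e ∧ e * Θ e = (κ₀ + jE V * ξ₀) * ρ (κ₀ + jE V * ξ₀) / (h * ρ h)) ∧ Valued.v (γ₁ * (V - W₁)) * Valued.v ((ϖ - σ ϖ) * ((ϖ * σ ϖ) ^ ((d - d % 2) / 2))⁻¹) ≤ 1)) hC (s₀ := normSign σ (-hW)) (normSign_eq_one_or σ (-hW))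
    beta_reduce at hF1
    have hS : Rd.filter (fun V => (Valued.v (γ₁ * (V - W₁)) = 1) ∧ ((Valued.v (κ₀ + jE V * ξ₀) * Valued.v (jE ϖ ^ j * (α - ρ α)) = Valued.v (jE ϖ) ^ b ∧ ∃ e : M, ρ e = e ∧ e * Θ e = (κ₀ + jE V * ξ₀) * ρ (κ₀ + jE V * ξ₀) / (h * ρ h)) ∧ Valued.v (γ₁ * (V - W₁)) * Valued.v ((ϖ - σ ϖ) * ((ϖ * σ ϖ) ^ ((d - d % 2) / 2))⁻¹) ≤ 1)) = (Rd.filter (fun V => ((Valued.v (κ₀ + jE V * ξ₀) * Valued.v (jE ϖ ^ j * (α - ρ α)) = Valued.v (jE ϖ) ^ b ∧ ∃ e : M, ρ e = e ∧ e * Θ e = (κ₀ + jE V * ξ₀) * ρ (κ₀ + jE V * ξ₀) / (h * ρ h)) ∧ Valued.v (γ₁ * (V - W₁)) * Valued.v ((ϖ - σ ϖ) * ((ϖ * σ ϖ) ^ ((d - d % 2) / 2))⁻¹) ≤ 1))).filter (fun V => (Valued.v (γ₁ * (V - W₁)) = 1)) := by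
      ext V
      simp only [Finset.mem_filter]
      exact ⟨fun hV => ⟨⟨hV.1, hV.2.2⟩, hV.2.1⟩, fun hV => ⟨hV.1.1, hV.2, hV.1.2⟩⟩
    rw [hS] at hF1
    have e1 : ((Rd.filter (fun V => ((Valued.v (κ₀ + jE V * ξ₀) * Valued.v (jE ϖ ^ j * (α - ρ α)) = Valued.v (jE ϖ) ^ b ∧ ∃ e : M, ρ e = e ∧ e * Θ e = (κ₀ + jE V * ξ₀) * ρ (κ₀ + jE V * ξ₀) / (h * ρ h)) ∧ Valued.v (γ₁ * (V - W₁)) * Valued.v ((ϖ - σ ϖ) * ((ϖ * σ ϖ) ^ ((d - d % 2) / 2))⁻¹) ≤ 1))).filter (fun V => (Valued.v (γ₁ * (V - W₁)) = 1))).filter (fun V => (Valued.v (γ₁ * (V - W₁)) = 1 → normSign σ (γ₁ * (V - W₁)) = normSign σ (-hW))) =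
        ((Rd.filter (fun V => ((Valued.v (κ₀ + jE V * ξ₀) * Valued.v (jE ϖ ^ j * (α - ρ α)) = Valued.v (jE ϖ) ^ b ∧ ∃ e : M, ρ e = e ∧ e * Θ e = (κ₀ + jE V * ξ₀) * ρ (κ₀ + jE V * ξ₀) / (h * ρ h)) ∧ Valued.v (γ₁ * (V - W₁)) * Valued.v ((ϖ - σ ϖ) * ((ϖ * σ ϖ) ^ ((d - d % 2) / 2))⁻¹) ≤ 1))).filter (fun V => (Valued.v (γ₁ * (V - W₁)) = 1))).filter (fun V => normSign σ (γ₁ * (V - W₁)) = normSign σ (-hW)) :=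
      Finset.filter_congr fun V hV => by
        have hN : (Valued.v (γ₁ * (V - W₁)) = 1) := (Finset.mem_filter.1 hV).2
        exact ⟨fun hψ => hψ hN, fun hs _ => hs⟩
    have e2 : ((Rd.filter (fun V => ((Valued.v (κ₀ + jE V * ξ₀) * Valued.v (jE ϖ ^ j * (α - ρ α)) = Valued.v (jE ϖ) ^ b ∧ ∃ e : M, ρ e = e ∧ e * Θ e = (κ₀ + jE V * ξ₀) * ρ (κ₀ + jE V * ξ₀) / (h * ρ h)) ∧ Valued.v (γ₁ * (V - W₁)) * Valued.v ((ϖ - σ ϖ) * ((ϖ * σ ϖ) ^ ((d - d % 2) / 2))⁻¹) ≤ 1))).filter (fun V => (Valued.v (γ₁ * (V - W₁)) = 1))).filter (fun V => ¬ (Valued.v (γ₁ * (V - W₁)) = 1 → normSign σ (γ₁ * (V - W₁)) = normSign σ (-hW))) =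
        ((Rd.filter (fun V => ((Valued.v (κ₀ + jE V * ξ₀) * Valued.v (jE ϖ ^ j * (α - ρ α)) = Valued.v (jE ϖ) ^ b ∧ ∃ e : M, ρ e = e ∧ e * Θ e = (κ₀ + jE V * ξ₀) * ρ (κ₀ + jE V * ξ₀) / (h * ρ h)) ∧ Valued.v (γ₁ * (V - W₁)) * Valued.v ((ϖ - σ ϖ) * ((ϖ * σ ϖ) ^ ((d - d % 2) / 2))⁻¹) ≤ 1))).filter (fun V => (Valued.v (γ₁ * (V - W₁)) = 1))).filter (fun V => ¬ normSign σ (γ₁ * (V - W₁)) = normSign σ (-hW)) :=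
      Finset.filter_congr fun V hV => by
        have hN : (Valued.v (γ₁ * (V - W₁)) = 1) := (Finset.mem_filter.1 hV).2
        exact not_congr ⟨fun hψ => hψ hN, fun hs _ => hs⟩
    rw [e1, e2]; exact hF1
  · -- hP: the population read (★ R1b-A §3)
    intro Λ x₀ hG
    exact weight_ne_zero_iff_cls_of_gen6 _hD h2v jE _hjv _hjfix _hΘj _hρρ _hvρ _hΘΘ _hΘρ _hvΘ _hΘh _hh hb1 hdb hcc hFgap _hhWσ hhW1 hlamj f _hf Λ x₀ hG
  · -- hL₁: the first literal read ((B) `reads_of_gen6_upperMix`)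
    intro Λ x₀ hG hfne; exact (hreads Λ x₀ hG hfne).1
  · -- hL₂: the second literal read ((B) `reads_of_gen6_upperMix`)
    intro Λ x₀ hG hfne; exact (hreads Λ x₀ hG hfne).2

end Summit.HodgeConjecture.HodgeConjecture.Cruxes.H413.F0P3cDyRamBeta2ConesOffRowUpperLowWorker

end
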